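import Literature.NumberTheory.GaloisRepresentations.ResidualRepUnique
import Literature.NumberTheory.GaloisRepresentations.AbsolutelyIrreducibleReduction
import Literature.NumberTheory.GaloisRepresentations.StableLatticeValuationRing
import Literature.NumberTheory.GaloisRepresentations.CalegariEvenFontaineMazurTwo
import Literature.RepresentationTheory.Semisimple.Semisimplification
import Mathlib.LinearAlgebra.Matrix.Charpoly.Coeff
import HarnessLib

/-!
# Trace-congruent representations have the same residual representations (rank `3`, `p ≥ 5`)

Topic `NumberTheory/GaloisRepresentations` (vocabulary of `ResidualGaloisRep.lean`:
`IsIntegralModelOf`, `integralReduction`, `IsReductionOf`, `HasResidualCharpolys`,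
`IsResidualRepOf`, `padicAlgClIntegers p = ℤ̄_p`, `padicAlgClResidueField p = ℤ̄_p/𝔪`).  A *proofs*
file: theorems only, no definition of a notion, no named fact (D-0026).

For continuous `ρ, r : Γ_K → GL₃(ℚ̄_p)` with **congruent traces** `‖tr ρ(σ) − tr r(σ)‖ < 1` for
all `σ` (i.e. `tr ρ ≡ tr r (mod 𝔪_{ℤ̄_p})`, the form in which residual hypotheses are typed in the
`Langlands` routes, e.g. `tr ρ ≡ η · (tr(ρ₀)²/det ρ₀ − 1)` in `RamifiedCoefficientSeed.AdjointLiftingGL3`)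
and `p ≥ 5`:

* `trace_integralReduction_eq_of_trace_congr` — any reductions `ρ̄`, `r̄` of integral models have
  `tr ρ̄(σ) = tr r̄(σ)` (traces are conjugation invariant and reduce mod `𝔪`);
* `charpoly_integralReduction_eq_of_trace_congr` — hence `det(X − ρ̄(σ)) = det(X − r̄(σ))`:
  apply the previous item to `σ, σ², σ³` and use NEWTON's identities in rank `3`
  (`Matrix.charpoly_eq_of_trace_pow_eq_three`: over a field with `2, 3 ≠ 0` the characteristic
  polynomial of a `3 × 3` matrix is determined by `tr A`, `tr A²`, `tr A³`; from the explicit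
  `Matrix.charpoly_fin_three`, `Matrix.trace_pow_two_fin_three`, `Matrix.trace_pow_three_fin_three`);
* `HasResidualCharpolys.of_trace_congr` — so `ρ` and `r` have the same residual characteristic
  polynomials;
* `FramedGaloisRep.IsResidualRepOf.of_trace_congr` — **and the same residual representations**:
  a residual representation `τ` of `ρ` (a semisimplified reduction) is a residual representation of
  `r`: for a reduction `r̄` of `r`, `τ` and a semisimplification of `r̄`
  (`exists_semisimplification`) are semisimple with the same characteristic polynomials, hence
  equivalent by Brauer–Nesbitt over `ℤ̄_p/𝔪` (`brauerNesbitt_holds`), which gives the kernel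
  clause `ker r̄ ≤ ker τ`.

This is the standard "`ρ ≡ r (mod 𝔪)` on traces ⟹ `ρ̄^{ss} ≅ r̄^{ss}`" for `p > n`
(Darmon–Diamond–Taylor §2.1: `ρ̄^{ss}` is determined by the characteristic polynomials, Prop. 2.6 (b);
traces determine characteristic polynomials when `n! ≠ 0`, Newton).  Rank `3` only (the rank the
route needs); the rank-`2` and general-rank versions are the same argument with
`Matrix.charpoly_fin_two` / the general Newton identities.

## References

* [DarmonDiamondTaylor1995] H. Darmon, F. Diamond, R. Taylor, *Fermat's Last Theorem* (1995), §2.1,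
  p. 54 and Prop. 2.6 (b).
* [BourbakiAlgebreVIII2012] N. Bourbaki, *Algèbre* VIII (2012), § 20 n° 6, Thm. 2, Cor. 1
  (Brauer–Nesbitt) — through `brauerNesbitt_holds`.
* [SerreAbelianLadic1968] J.-P. Serre, *Abelian ℓ-adic representations and elliptic curves* (1968),
  Ch. I §1.1 (integral models), §2.3.
-/

noncomputable section

open scoped MatrixGroups
open Matrix Polynomial IsLocalRing

/-! ### Newton's identities in rank `3` -/

namespace Matrix

variable {R : Type*} [CommRing R]

/-- The second coefficient of the characteristic polynomial of a `3 × 3` matrix: the sum of its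
principal `2 × 2` minors (the second elementary symmetric function of the eigenvalues). [folklore] -/
theorem charpoly_fin_three (M : Matrix (Fin 3) (Fin 3) R) :
    M.charpoly = X ^ 3 - C M.trace * X ^ 2 +
      C (M 0 0 * M 1 1 - M 0 1 * M 1 0 + (M 0 0 * M 2 2 - M 0 2 * M 2 0) +
        (M 1 1 * M 2 2 - M 1 2 * M 2 1)) * X - C M.det := by
  have e : ∀ i j : Fin 3, M.charmatrix i j = if i = j then X - C (M i j) else - C (M i j) := by
    intro i j
    split_ifs with h
    · subst h; exact Matrix.charmatrix_apply_eq M i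
    · exact Matrix.charmatrix_apply_ne M i j h
  rw [Matrix.charpoly, Matrix.det_fin_three]
  simp only [e, Matrix.trace, Fin.sum_univ_three, Matrix.diag_apply, Matrix.det_fin_three,
    map_sub, map_add, map_mul]
  simp
  ring

/-- `tr(M²)` for a `3 × 3` matrix: `(tr M)² − 2 e₂(M)`. [folklore] -/
theorem trace_pow_two_fin_three (M : Matrix (Fin 3) (Fin 3) R) :
    (M ^ 2).trace = M.trace ^ 2 -
      2 * (M 0 0 * M 1 1 - M 0 1 * M 1 0 + (M 0 0 * M 2 2 - M 0 2 * M 2 0) +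
        (M 1 1 * M 2 2 - M 1 2 * M 2 1)) := by
  simp only [Matrix.trace, Fin.sum_univ_three, Matrix.diag_apply, pow_two, Matrix.mul_apply]
  ring

/-- `tr(M³)` for a `3 × 3` matrix: `(tr M)³ − 3 tr(M) e₂(M) + 3 det M`. [folklore] -/
theorem trace_pow_three_fin_three (M : Matrix (Fin 3) (Fin 3) R) :
    (M ^ 3).trace = M.trace ^ 3 -
      3 * M.trace * (M 0 0 * M 1 1 - M 0 1 * M 1 0 + (M 0 0 * M 2 2 - M 0 2 * M 2 0) +
        (M 1 1 * M 2 2 - M 1 2 * M 2 1)) + 3 * M.det := by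
  simp only [Matrix.trace, Fin.sum_univ_three, Matrix.diag_apply, pow_succ, pow_zero,
    Matrix.one_mul, Matrix.mul_apply, Matrix.det_fin_three]
  ring

/-- **Newton's identities, rank `3`**: over a commutative ring in which `2` and `3` are not zero
divisors (e.g. a field of characteristic `≠ 2, 3`), two `3 × 3` matrices with
`tr A = tr B`, `tr A² = tr B²`, `tr A³ = tr B³` have the same characteristic polynomial. [folklore] -/
theorem charpoly_eq_of_trace_pow_eq_three {k : Type*} [Field k] (h2 : (2 : k) ≠ 0)
    (h3 : (3 : k) ≠ 0) {A B : Matrix (Fin 3) (Fin 3) k} (h₁ : A.trace = B.trace)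
    (h₂ : (A ^ 2).trace = (B ^ 2).trace) (h₃ : (A ^ 3).trace = (B ^ 3).trace) :
    A.charpoly = B.charpoly := by
  set mA := A 0 0 * A 1 1 - A 0 1 * A 1 0 + (A 0 0 * A 2 2 - A 0 2 * A 2 0) +
    (A 1 1 * A 2 2 - A 1 2 * A 2 1) with hmA
  set mB := B 0 0 * B 1 1 - B 0 1 * B 1 0 + (B 0 0 * B 2 2 - B 0 2 * B 2 0) +
    (B 1 1 * B 2 2 - B 1 2 * B 2 1) with hmB
  have ha₂ := trace_pow_two_fin_three A
  have hb₂ := trace_pow_two_fin_three B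
  have ha₃ := trace_pow_three_fin_three A
  have hb₃ := trace_pow_three_fin_three B
  rw [← hmA] at ha₂ ha₃
  rw [← hmB] at hb₂ hb₃
  have hm : mA = mB := by
    apply mul_left_cancel₀ h2
    linear_combination ha₂ - hb₂ + (A.trace + B.trace) * h₁ - h₂
  have hd : A.det = B.det := by
    apply mul_left_cancel₀ h3
    linear_combination -ha₃ + hb₃ + h₃ - (A.trace ^ 2 + A.trace * B.trace + B.trace ^ 2) * h₁ +
      3 * A.trace * hm + 3 * mB * h₁
  rw [charpoly_fin_three, charpoly_fin_three, ← hmA, ← hmB, h₁, hm, hd]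

end Matrix

namespace Literature.NumberTheory.GaloisRepresentations

universe u

/-! ### Traces of integral models and of their reductions -/

section IntegralModel

variable {F : Type*} [Field F] {O : ValuationSubring F} {G : Type*} [Group G] {n : ℕ}
variable {k : Type*} [Field k]

/-- The trace of an integral model `ρ₀ = P⁻¹ ρ P` is the trace of `ρ` (conjugation invariance).
[cite: SerreAbelianLadic1968, Ch. I §1.1] -/
theorem IsIntegralModelOf.coe_trace {ρ : G →* GL (Fin n) F} {ρ₀ : G →* GL (Fin n) O}
    (h : IsIntegralModelOf ρ ρ₀) (g : G) :
    ((((ρ₀ g : GL (Fin n) O) : Matrix (Fin n) (Fin n) O).trace : O) : F) =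
      ((ρ g : GL (Fin n) F) : Matrix (Fin n) (Fin n) F).trace := by
  obtain ⟨P, hP⟩ := h
  have h1 : (((ρ₀ g : GL (Fin n) O) : Matrix (Fin n) (Fin n) O).map O.subtype).trace =
      ((P⁻¹ * ρ g * P : GL (Fin n) F) : Matrix (Fin n) (Fin n) F).trace := by
    rw [← hP g]; rfl
  rw [Units.val_mul, Units.val_mul, Matrix.trace_mul_cycle, ← Units.val_mul, mul_inv_cancel,
    Units.val_one, Matrix.one_mul] at h1
  rw [← h1, ← AddMonoidHom.map_trace]
  rfl

/-- The trace of the reduction `ρ₀ mod 𝔪` (pushed along `ι`) is the image of `tr ρ₀`. [folklore] -/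
theorem trace_integralReduction (ι : ResidueField O →+* k) (ρ₀ : G →* GL (Fin n) O) (g : G) :
    ((integralReduction ι ρ₀ g : GL (Fin n) k) : Matrix (Fin n) (Fin n) k).trace =
      ι (residue O (((ρ₀ g : GL (Fin n) O) : Matrix (Fin n) (Fin n) O).trace)) := by
  have : ((integralReduction ι ρ₀ g : GL (Fin n) k) : Matrix (Fin n) (Fin n) k) =
      (((ρ₀ g : GL (Fin n) O) : Matrix (Fin n) (Fin n) O)).map (ι.comp (residue O)) := rfl
  rw [this, ← AddMonoidHom.map_trace]
  rfl

end IntegralModel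

/-! ### The `ℚ̄_p` case: trace congruence -/

section PadicAlgCl

variable {p : ℕ} [Fact p.Prime] {G : Type*} [Group G] {n : ℕ}

/-- Two elements of `ℤ̄_p` at distance `< 1` have the same residue. [folklore] -/
theorem residue_eq_of_norm_sub_lt_one {x y : padicAlgClIntegers p}
    (h : ‖(x : PadicAlgCl p) - y‖ < 1) :
    residue (padicAlgClIntegers p) x = residue (padicAlgClIntegers p) y := by
  rw [← sub_eq_zero, ← map_sub, residue_eq_zero_iff,
    mem_maximalIdeal_iff_norm_lt_one (padicAlgCl_mem_valuationSubring_iff p)]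
  exact h

/-- **Trace-congruent representations have reductions with equal traces.**  If
`‖tr ρ(g) − tr r(g)‖ < 1` and `ρ₀`, `r₀` are integral models of `ρ, r : G → GL_n(ℚ̄_p)` over
`ℤ̄_p`, then `tr (ρ₀ mod 𝔪)(g) = tr (r₀ mod 𝔪)(g)`. [cite: DarmonDiamondTaylor1995, §2.1, p. 54] -/
theorem trace_integralReduction_eq_of_trace_congr {ρ r : G →* GL (Fin n) (PadicAlgCl p)}
    {ρ₀ r₀ : G →* GL (Fin n) (padicAlgClIntegers p)} (hρ : IsIntegralModelOf ρ ρ₀)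
    (hr : IsIntegralModelOf r r₀) {g : G}
    (h : ‖((ρ g : GL (Fin n) (PadicAlgCl p)) : Matrix (Fin n) (Fin n) (PadicAlgCl p)).trace -
      ((r g : GL (Fin n) (PadicAlgCl p)) : Matrix (Fin n) (Fin n) (PadicAlgCl p)).trace‖ < 1)
    {k : Type*} [Field k] (ι : padicAlgClResidueField p →+* k) :
    ((integralReduction ι ρ₀ g : GL (Fin n) k) : Matrix (Fin n) (Fin n) k).trace =
      ((integralReduction ι r₀ g : GL (Fin n) k) : Matrix (Fin n) (Fin n) k).trace := by
  rw [trace_integralReduction, trace_integralReduction]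
  congr 1
  apply residue_eq_of_norm_sub_lt_one
  rw [hρ.coe_trace, hr.coe_trace]
  exact h

omit [Fact p.Prime] in
/-- `2 ≠ 0` and `3 ≠ 0` in a field of characteristic `p ≥ 5`. [folklore] -/
theorem two_ne_zero_and_three_ne_zero_of_charP {k : Type*} [Field k] [CharP k p] (hp : 5 ≤ p) :
    (2 : k) ≠ 0 ∧ (3 : k) ≠ 0 := by
  have h2 : ¬ p ∣ 2 := fun h => by have := Nat.le_of_dvd two_pos h; omega
  have h3 : ¬ p ∣ 3 := fun h => by have := Nat.le_of_dvd (by norm_num) h; omega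
  refine ⟨fun h => h2 ?_, fun h => h3 ?_⟩
  · exact (CharP.cast_eq_zero_iff k p 2).mp (by exact_mod_cast h)
  · exact (CharP.cast_eq_zero_iff k p 3).mp (by exact_mod_cast h)

/-- **Trace-congruent rank-`3` representations have reductions with the same characteristic
polynomials** (`p ≥ 5`): apply `trace_integralReduction_eq_of_trace_congr` to `g, g², g³` and
Newton's identities in rank `3` (`Matrix.charpoly_eq_of_trace_pow_eq_three`; `2, 3 ≠ 0` in `ℤ̄_p/𝔪`,
which has characteristic `p`). [cite: DarmonDiamondTaylor1995, §2.1, p. 54] -/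
theorem charpoly_integralReduction_eq_of_trace_congr (hp : 5 ≤ p)
    {ρ r : G →* GL (Fin 3) (PadicAlgCl p)} {ρ₀ r₀ : G →* GL (Fin 3) (padicAlgClIntegers p)}
    (hρ : IsIntegralModelOf ρ ρ₀) (hr : IsIntegralModelOf r r₀)
    (h : ∀ g, ‖((ρ g : GL (Fin 3) (PadicAlgCl p)) : Matrix (Fin 3) (Fin 3) (PadicAlgCl p)).trace -
      ((r g : GL (Fin 3) (PadicAlgCl p)) : Matrix (Fin 3) (Fin 3) (PadicAlgCl p)).trace‖ < 1)
    (g : G) :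
    ((integralReduction (RingHom.id _) ρ₀ g : GL (Fin 3) (padicAlgClResidueField p)) :
        Matrix (Fin 3) (Fin 3) (padicAlgClResidueField p)).charpoly =
      ((integralReduction (RingHom.id _) r₀ g : GL (Fin 3) (padicAlgClResidueField p)) :
        Matrix (Fin 3) (Fin 3) (padicAlgClResidueField p)).charpoly := by
  haveI := charP_padicAlgClResidueField p
  obtain ⟨h2, h3⟩ := two_ne_zero_and_three_ne_zero_of_charP (k := padicAlgClResidueField p) hp
  have hpow : ∀ (σ : G →* GL (Fin 3) (padicAlgClResidueField p)) (i : ℕ),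
      (((σ g : GL (Fin 3) (padicAlgClResidueField p)) :
        Matrix (Fin 3) (Fin 3) (padicAlgClResidueField p)) ^ i) =
        ((σ (g ^ i) : GL (Fin 3) (padicAlgClResidueField p)) :
          Matrix (Fin 3) (Fin 3) (padicAlgClResidueField p)) := fun σ i => by
    rw [map_pow, Units.val_pow_eq_pow_val]
  refine Matrix.charpoly_eq_of_trace_pow_eq_three h2 h3 ?_ ?_ ?_
  · exact trace_integralReduction_eq_of_trace_congr hρ hr (h g) (RingHom.id _)
  · rw [hpow, hpow]
    exact trace_integralReduction_eq_of_trace_congr hρ hr (h (g ^ 2)) (RingHom.id _)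
  · rw [hpow, hpow]
    exact trace_integralReduction_eq_of_trace_congr hρ hr (h (g ^ 3)) (RingHom.id _)

/-- **Trace-congruent rank-`3` representations have the same residual characteristic polynomials**
(`p ≥ 5`): if `τ : G → GL₃(ℤ̄_p/𝔪)` has the residual characteristic polynomials of `ρ`, it has
those of `r`.  (Integral models over `ℤ̄_p` are supplied by the caller; for compact `G` they exist,
`exists_integralModel_of_valuationSubring`.) [cite: DarmonDiamondTaylor1995, §2.1, Prop. 2.6 (b)] -/
theorem HasResidualCharpolys.of_trace_congr (hp : 5 ≤ p)
    {ρ r : G →* GL (Fin 3) (PadicAlgCl p)} {ρ₀ r₀ : G →* GL (Fin 3) (padicAlgClIntegers p)}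
    (hρ : IsIntegralModelOf ρ ρ₀) (hr : IsIntegralModelOf r r₀)
    (h : ∀ g, ‖((ρ g : GL (Fin 3) (PadicAlgCl p)) : Matrix (Fin 3) (Fin 3) (PadicAlgCl p)).trace -
      ((r g : GL (Fin 3) (PadicAlgCl p)) : Matrix (Fin 3) (Fin 3) (PadicAlgCl p)).trace‖ < 1)
    {τ : G →* GL (Fin 3) (padicAlgClResidueField p)}
    (hτ : HasResidualCharpolys (O := padicAlgClIntegers p) (RingHom.id (padicAlgClResidueField p))
      ρ τ) :
    HasResidualCharpolys (O := padicAlgClIntegers p) (RingHom.id (padicAlgClResidueField p)) r τ := by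
  -- the reductions of the two models
  have hρb : IsReductionOf (O := padicAlgClIntegers p) (RingHom.id (padicAlgClResidueField p)) ρ
      (integralReduction (RingHom.id (padicAlgClResidueField p)) ρ₀) :=
    ⟨ρ₀, 1, hρ, fun g => by rw [inv_one, one_mul, mul_one]⟩
  have hrb : IsReductionOf (O := padicAlgClIntegers p) (RingHom.id (padicAlgClResidueField p)) r
      (integralReduction (RingHom.id (padicAlgClResidueField p)) r₀) :=
    ⟨r₀, 1, hr, fun g => by rw [inv_one, one_mul, mul_one]⟩
  intro g
  obtain ⟨Q, hQ, hQ'⟩ := hrb.hasResidualCharpolys g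
  exact ⟨Q, hQ, hQ'.trans ((charpoly_integralReduction_eq_of_trace_congr hp hρ hr h g).symm.trans
    (hρb.hasResidualCharpolys.charpoly_eq hτ g))⟩

end PadicAlgCl

/-! ### Residual representations -/

section Residual

variable {K : Type u} [Field K] [CharZero K] {p : ℕ} [Fact p.Prime]

/-- An equivalence of the representations on `kⁿ` through `τ, σ : G → GL_n(k)` identifies kernels.
[folklore] -/
theorem ker_le_ker_of_equiv {G : Type*} [Group G] {k : Type*} [Field k] {n : ℕ}
    {τ σ : G →* GL (Fin n) k} (e : (glRepresentation τ).Equiv (glRepresentation σ)) :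
    σ.ker ≤ τ.ker := by
  intro g hg
  rw [MonoidHom.mem_ker] at hg ⊢
  have hfix : ∀ v : Fin n → k, glRepresentation τ g v = v := by
    intro v
    apply e.toLinearEquiv.injective
    rw [Representation.Equiv.toLinearEquiv_apply, Representation.Equiv.toLinearEquiv_apply,
      Representation.IntertwiningMap.isIntertwining _ _ e.toIntertwiningMap g v,
      glRepresentation_apply_apply, hg, Units.val_one, Matrix.one_mulVec]
  -- `τ g` acts trivially on `kⁿ`, hence is `1`
  refine Units.ext (Matrix.ext fun i j => ?_)
  have hv := congrFun (hfix (Pi.single j 1)) i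
  rw [glRepresentation_apply_apply, Matrix.mulVec_single_one, Matrix.col_apply] at hv
  rw [hv, Units.val_one, Matrix.one_apply, Pi.single_apply]

/-- **Trace-congruent rank-`3` representations of `Γ_K` have the same residual representations**
(`p ≥ 5`).  Let `ρ, r : Γ_K → GL₃(ℚ̄_p)` be continuous with `‖tr ρ(σ) − tr r(σ)‖ < 1` for all `σ`,
and let `τ : Γ_K → GL₃(ℤ̄_p/𝔪)` be a residual representation of `ρ` (a semisimplified reduction).
Then `τ` is a residual representation of `r`: both have integral models
(`exists_integralModel_of_valuationSubring`), so `τ` has the residual characteristic polynomials of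
`r` (`HasResidualCharpolys.of_trace_congr`); for the reduction `r̄` of a model of `r` and a
semisimplification `r̄'` of `r̄` (`exists_semisimplification`), `τ` and `r̄'` are semisimple with
the same characteristic polynomials, hence equivalent (Brauer–Nesbitt, `brauerNesbitt_holds`), so
`ker r̄ ≤ ker r̄' = ker τ` and `τ` is a semisimplification of the reduction `r̄` of `r`.
[cite: DarmonDiamondTaylor1995, §2.1, p. 54 and Prop. 2.6 (b)] -/
theorem FramedGaloisRep.IsResidualRepOf.of_trace_congr (hp : 5 ≤ p)
    (ρ r : FramedGaloisRep K (PadicAlgCl p) 3)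
    (h : ∀ σ, ‖(ρ σ).val.trace - (r σ).val.trace‖ < 1)
    {τ : Field.absoluteGaloisGroup K →* GL (Fin 3) (padicAlgClResidueField p)}
    (hτ : ρ.IsResidualRepOf (RingHom.id _) τ) : r.IsResidualRepOf (RingHom.id _) τ := by
  -- integral models of `ρ` and `r` over `ℤ̄_p`
  obtain ⟨P, ρ₀, hP⟩ := exists_integralModel_of_valuationSubring (O := padicAlgClIntegers p)
    (Valued.isOpen_valuationSubring (PadicAlgCl p)) ρ
  obtain ⟨Q, r₀, hQ⟩ := exists_integralModel_of_valuationSubring (O := padicAlgClIntegers p)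
    (Valued.isOpen_valuationSubring (PadicAlgCl p)) r
  have hρ : IsIntegralModelOf (ρ : Field.absoluteGaloisGroup K →* GL (Fin 3) (PadicAlgCl p)) ρ₀ :=
    ⟨P, fun g => hP g⟩
  have hr : IsIntegralModelOf (r : Field.absoluteGaloisGroup K →* GL (Fin 3) (PadicAlgCl p)) r₀ :=
    ⟨Q, fun g => hQ g⟩
  set rb := integralReduction (RingHom.id (padicAlgClResidueField p)) r₀ with hrbdef
  have hrb : r.IsReductionOf (RingHom.id _) rb :=
    ⟨r₀, 1, hr, fun g => by rw [inv_one, one_mul, mul_one]⟩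
  -- `τ` has the residual characteristic polynomials of `r`, i.e. those of `rb`
  have hτr : HasResidualCharpolys (O := padicAlgClIntegers p) (RingHom.id (padicAlgClResidueField p))
      (r : Field.absoluteGaloisGroup K →* GL (Fin 3) (PadicAlgCl p)) τ :=
    HasResidualCharpolys.of_trace_congr hp hρ hr (fun g => h g)
      (GaloisRepresentations.IsResidualRepOf.hasResidualCharpolys hτ)
  have hcp : ∀ g, ((τ g : GL (Fin 3) (padicAlgClResidueField p)) :
      Matrix (Fin 3) (Fin 3) (padicAlgClResidueField p)).charpoly =
      ((rb g : GL (Fin 3) (padicAlgClResidueField p)) :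
        Matrix (Fin 3) (Fin 3) (padicAlgClResidueField p)).charpoly :=
    fun g => hτr.charpoly_eq (GaloisRepresentations.IsReductionOf.hasResidualCharpolys hrb) g
  -- a semisimplification `rb'` of `rb`, equivalent to `τ` by Brauer–Nesbitt
  obtain ⟨rb', hss', hcp', hker'⟩ :=
    Literature.RepresentationTheory.Semisimple.exists_semisimplification rb
  have hτss : (glRepresentation τ).IsSemisimpleRepresentation :=
    GaloisRepresentations.IsResidualRepOf.isSemisimpleRepresentation hτ
  obtain ⟨e⟩ : Nonempty ((glRepresentation τ).Equiv (glRepresentation rb')) := by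
    refine brauerNesbitt_holds (glRepresentation τ) (glRepresentation rb') hτss hss' fun g => ?_
    have eτ : (glRepresentation τ g : (Fin 3 → padicAlgClResidueField p) →ₗ[padicAlgClResidueField p]
        (Fin 3 → padicAlgClResidueField p)) =
        Matrix.toLin' ((τ g : GL (Fin 3) (padicAlgClResidueField p)) : Matrix (Fin 3) (Fin 3) _) :=
      LinearMap.ext fun v => by rw [Matrix.toLin'_apply]; rfl
    have er : (glRepresentation rb' g : (Fin 3 → padicAlgClResidueField p) →ₗ[padicAlgClResidueField p]
        (Fin 3 → padicAlgClResidueField p)) =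
        Matrix.toLin' ((rb' g : GL (Fin 3) (padicAlgClResidueField p)) : Matrix (Fin 3) (Fin 3) _) :=
      LinearMap.ext fun v => by rw [Matrix.toLin'_apply]; rfl
    rw [eτ, er, Matrix.charpoly_toLin', Matrix.charpoly_toLin', hcp g, hcp' g]
  -- `τ` is a semisimplification of the reduction `rb` of `r`
  exact ⟨rb, hrb, hτss, hcp, fun g hg => ker_le_ker_of_equiv e (hker' hg)⟩

end Residual

end Literature.NumberTheory.GaloisRepresentations

end
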